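import Summits.RiemannHypothesis.RiemannHypothesis.Theorems.IntegerScrewCensusDualModel

/-!
# Route `IntegerScrew` — kernel checker for the census DUAL certificates (6b): the derivative models of a cell

Continuation of `IntegerScrewCensusDualModel`: coefficients of the formal derivative (`getD_derivZ`), and the first- and
second-derivative models of a cell as sums over terms (`model1_eq`, `model2_eq`).  RH-free; nothing here bears on the
truth of RH.
-/

set_option linter.dupNamespace false
set_option autoImplicit false

namespace Summit.RiemannHypothesis.RiemannHypothesis.Theorems.IntegerScrew.Manifest.Fast

open Finset Complex
open Literature.Analysis.ValidatedNumerics.KroneckerDot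

/-! ### The derivative models -/

/-- Entries of `addZ`. -/
theorem getD_addZ : ∀ (p q : List ℤ) (k : ℕ), (addZ p q).getD k 0 = p.getD k 0 + q.getD k 0
  | [], q, k => by simp [addZ]
  | p :: ps, [], k => by cases k <;> simp [addZ]
  | p :: ps, q :: qs, 0 => by simp [addZ]
  | p :: ps, q :: qs, k + 1 => by simp only [addZ, List.getD_cons_succ]; exact getD_addZ ps qs k

/-- **Coefficients of the formal derivative**: `(derivZ cs)_k = (k+1)·cs_{k+1}`. -/
theorem getD_derivZ : ∀ (cs : List ℤ) (k : ℕ), (derivZ cs).getD k 0 = ((k : ℤ) + 1) * cs.getD (k + 1) 0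
  | [], k => by simp [derivZ]
  | c :: cs, 0 => by
    show (addZ cs (0 :: derivZ cs)).getD 0 0 = _
    rw [getD_addZ]; simp
  | c :: cs, k + 1 => by
    show (addZ cs (0 :: derivZ cs)).getD (k + 1) 0 = _
    rw [getD_addZ, List.getD_cons_succ, getD_derivZ cs k, List.getD_cons_succ]
    push_cast; ring

/-- `derivZ` preserves the length. -/
theorem length_derivZ_eq : ∀ (cs : List ℤ), (derivZ cs).length = cs.length
  | [] => rfl
  | c :: cs => by
    show (addZ cs (0 :: derivZ cs)).length = _
    rw [length_addZ, List.length_cons, length_derivZ_eq cs, List.length_cons]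
    exact max_eq_right (Nat.le_succ _)

/-- `evalZ (derivZ cs) x = Σ_{k<|cs|} (k+1) cs_{k+1} x^k` (the last term vanishes). -/
theorem evalZ_derivZ_sum (cs : List ℤ) (x : ℝ) :
    evalZ (derivZ cs) x = ∑ k ∈ range cs.length, (((k : ℤ) + 1) * cs.getD (k + 1) 0 : ℤ) * x ^ k := by
  rw [evalZ_eq_sum, length_derivZ_eq]
  exact Finset.sum_congr rfl fun k _ => by rw [getD_derivZ]

/-- The first-derivative weight series `S¹_φ(σ) = Σ_{k<D} (k+1) W_{k+1} i^{k+1} σ^k`. -/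
noncomputable def wSer1 (cs : List (ℕ × ℕ)) (φ : ℕ) (σ : ℝ) : ℂ :=
  ∑ k ∈ range (cs.length - 1), ((k + 1 : ℕ) : ℂ) * (wAt cs φ (k + 1) : ℂ) * I ^ (k + 1) * (σ : ℂ) ^ k

/-- The second-derivative weight series `S²_φ(σ) = Σ_{k<D−1} (k+1)(k+2) W_{k+2} i^{k+2} σ^k`. -/
noncomputable def wSer2 (cs : List (ℕ × ℕ)) (φ : ℕ) (σ : ℝ) : ℂ :=
  ∑ k ∈ range (cs.length - 2), ((k + 1 : ℕ) : ℂ) * ((k + 2 : ℕ) : ℂ) * (wAt cs φ (k + 2) : ℂ) * I ^ (k + 2) * (σ : ℂ) ^ k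

/-- **The first-derivative model of a cell as a sum over terms.** -/
theorem model1_eq {D E : ℕ} (Z : List (List ℤ)) (φs : List ℕ) (xys : List (ℤ × ℤ)) (c : ℤ)
    (hsq : ∀ row ∈ Z, row.length = Z.length) (hφ : Z.length ≤ φs.length) (hx : Z.length ≤ xys.length)
    (hRE : ∀ k, k < D + 1 → |dRE (kConsts D E) Z φs xys k| < 2 ^ (SW - 1))
    (hIM : ∀ k, k < D + 1 → |dIM (kConsts D E) Z φs xys k| < 2 ^ (SW - 1)) (σ : ℝ) :
    evalZ (derivZ (gList D (halfPack D) (accNodes xys (nodeData (kConsts D E) Z φs) xys) c)) σ =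
      (∑ a ∈ range Z.length, ∑ b ∈ range a,
          (2 * ((Z.getD a []).getD b 0 : ℤ) : ℂ) * (zh xys a * (starRingEnd ℂ) (zh xys b)) *
            wSer1 (kConsts D E) (φs.getD a 0 - φs.getD b 0) σ +
        ∑ a ∈ range Z.length, ((-2 * sumZ (Z.getD a []) * ((SCL : ℕ) : ℤ) : ℤ) : ℂ) * zh xys a *
          wSer1 (kConsts D E) (φs.getD a 0) σ).re := by
  rw [evalZ_derivZ_sum, length_gList, Finset.sum_range_succ]
  -- the last term vanishes (`G_{D+1} = 0`)
  rw [show (gList D (halfPack D) (accNodes xys (nodeData (kConsts D E) Z φs) xys) c).getD (D + 1) 0 = 0 from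
    List.getD_eq_default _ _ (by rw [length_gList]), mul_zero, Int.cast_zero, zero_mul, add_zero]
  have hcoef : ∀ k ∈ range D, ((((k : ℤ) + 1) * (gList D (halfPack D) (accNodes xys (nodeData (kConsts D E) Z φs) xys) c).getD (k + 1) 0 : ℤ) : ℝ) * σ ^ k =
      (((k + 1 : ℕ) : ℂ) * ((((dRE (kConsts D E) Z φs xys (k + 1) : ℤ) : ℂ) + ((dIM (kConsts D E) Z φs xys (k + 1) : ℤ) : ℂ) * I) *
        I ^ (k + 1)) * (σ : ℂ) ^ k).re := by
    intro k hk
    rw [Finset.mem_range] at hk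
    rw [getD_gList D _ _ c (by omega), if_neg (by omega), gAt_eq_sel Z φs xys hsq hφ hx hRE hIM (by omega), Int.cast_mul,
      sel_eq_re,
      show ((k + 1 : ℕ) : ℂ) * ((((dRE (kConsts D E) Z φs xys (k + 1) : ℤ) : ℂ) + ((dIM (kConsts D E) Z φs xys (k + 1) : ℤ) : ℂ) * I) *
          I ^ (k + 1)) * (σ : ℂ) ^ k =
        ((((k : ℝ) + 1) * σ ^ k : ℝ) : ℂ) * ((((dRE (kConsts D E) Z φs xys (k + 1) : ℤ) : ℂ) +
          ((dIM (kConsts D E) Z φs xys (k + 1) : ℤ) : ℂ) * I) * I ^ (k + 1)) by push_cast; ring,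
      Complex.re_ofReal_mul]
    push_cast; ring
  rw [Finset.sum_congr rfl hcoef, ← Complex.re_sum]
  congr 1
  simp only [digit_complex, mul_add, add_mul]
  rw [Finset.sum_add_distrib]
  unfold wSer1
  rw [length_kConsts, Nat.add_sub_cancel]
  congr 1
  · simp only [Finset.mul_sum, Finset.sum_mul]
    rw [Finset.sum_comm]
    refine Finset.sum_congr rfl fun a _ => ?_
    rw [Finset.sum_comm]
    refine Finset.sum_congr rfl fun b _ => ?_
    refine Finset.sum_congr rfl fun k _ => ?_
    unfold pairW
    push_cast
    ring
  · simp only [Finset.mul_sum, Finset.sum_mul]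
    rw [Finset.sum_comm]
    refine Finset.sum_congr rfl fun a _ => ?_
    refine Finset.sum_congr rfl fun k _ => ?_
    unfold nodeW
    push_cast
    ring

/-- **The second-derivative model of a cell as a sum over terms.** -/
theorem model2_eq {D E : ℕ} (Z : List (List ℤ)) (φs : List ℕ) (xys : List (ℤ × ℤ)) (c : ℤ)
    (hsq : ∀ row ∈ Z, row.length = Z.length) (hφ : Z.length ≤ φs.length) (hx : Z.length ≤ xys.length)
    (hRE : ∀ k, k < D + 1 → |dRE (kConsts D E) Z φs xys k| < 2 ^ (SW - 1))
    (hIM : ∀ k, k < D + 1 → |dIM (kConsts D E) Z φs xys k| < 2 ^ (SW - 1)) (hD : 1 ≤ D) (σ : ℝ) :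
    evalZ (derivZ (derivZ (gList D (halfPack D) (accNodes xys (nodeData (kConsts D E) Z φs) xys) c))) σ =
      (∑ a ∈ range Z.length, ∑ b ∈ range a,
          (2 * ((Z.getD a []).getD b 0 : ℤ) : ℂ) * (zh xys a * (starRingEnd ℂ) (zh xys b)) *
            wSer2 (kConsts D E) (φs.getD a 0 - φs.getD b 0) σ +
        ∑ a ∈ range Z.length, ((-2 * sumZ (Z.getD a []) * ((SCL : ℕ) : ℤ) : ℤ) : ℂ) * zh xys a *
          wSer2 (kConsts D E) (φs.getD a 0) σ).re := by
  rw [evalZ_derivZ_sum, length_derivZ_eq, length_gList]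
  obtain ⟨D', rfl⟩ : ∃ D', D = D' + 1 := ⟨D - 1, by omega⟩
  rw [Finset.sum_range_succ, Finset.sum_range_succ]
  -- the last two terms vanish
  have hz1 : (gList (D' + 1) (halfPack (D' + 1)) (accNodes xys (nodeData (kConsts (D' + 1) E) Z φs) xys) c).getD (D' + 1 + 1) 0 = 0 :=
    List.getD_eq_default _ _ (by rw [length_gList])
  have hz2 : (gList (D' + 1) (halfPack (D' + 1)) (accNodes xys (nodeData (kConsts (D' + 1) E) Z φs) xys) c).getD (D' + 1 + 1 + 1) 0 = 0 :=
    List.getD_eq_default _ _ (by rw [length_gList]; omega)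
  rw [getD_derivZ, getD_derivZ, hz1, hz2]
  simp only [mul_zero, Int.cast_zero, zero_mul, add_zero]
  have hcoef : ∀ k ∈ range D', ((((k : ℤ) + 1) * (derivZ (gList (D' + 1) (halfPack (D' + 1))
      (accNodes xys (nodeData (kConsts (D' + 1) E) Z φs) xys) c)).getD (k + 1) 0 : ℤ) : ℝ) * σ ^ k =
      (((k + 1 : ℕ) : ℂ) * ((k + 2 : ℕ) : ℂ) * ((((dRE (kConsts (D' + 1) E) Z φs xys (k + 2) : ℤ) : ℂ) +
        ((dIM (kConsts (D' + 1) E) Z φs xys (k + 2) : ℤ) : ℂ) * I) * I ^ (k + 2)) * (σ : ℂ) ^ k).re := by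
    intro k hk
    rw [Finset.mem_range] at hk
    rw [getD_derivZ, getD_gList _ _ _ c (by omega), if_neg (by omega), gAt_eq_sel Z φs xys hsq hφ hx hRE hIM (by omega),
      Int.cast_mul, Int.cast_mul, sel_eq_re,
      show ((k + 1 : ℕ) : ℂ) * ((k + 2 : ℕ) : ℂ) * ((((dRE (kConsts (D' + 1) E) Z φs xys (k + 2) : ℤ) : ℂ) +
          ((dIM (kConsts (D' + 1) E) Z φs xys (k + 2) : ℤ) : ℂ) * I) * I ^ (k + 2)) * (σ : ℂ) ^ k =
        ((((k : ℝ) + 1) * ((k : ℝ) + 2) * σ ^ k : ℝ) : ℂ) * ((((dRE (kConsts (D' + 1) E) Z φs xys (k + 2) : ℤ) : ℂ) +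
          ((dIM (kConsts (D' + 1) E) Z φs xys (k + 2) : ℤ) : ℂ) * I) * I ^ (k + 2)) by push_cast; ring,
      Complex.re_ofReal_mul, show (k + 1 + 1 : ℕ) = k + 2 by omega]
    push_cast; ring
  rw [Finset.sum_congr rfl hcoef, ← Complex.re_sum]
  congr 1
  simp only [digit_complex, mul_add, add_mul]
  rw [Finset.sum_add_distrib]
  unfold wSer2
  rw [length_kConsts, show D' + 1 + 1 - 2 = D' by omega]
  congr 1
  · simp only [Finset.mul_sum, Finset.sum_mul]
    rw [Finset.sum_comm]
    refine Finset.sum_congr rfl fun a _ => ?_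
    rw [Finset.sum_comm]
    refine Finset.sum_congr rfl fun b _ => ?_
    refine Finset.sum_congr rfl fun k _ => ?_
    unfold pairW
    push_cast
    ring
  · simp only [Finset.mul_sum, Finset.sum_mul]
    rw [Finset.sum_comm]
    refine Finset.sum_congr rfl fun a _ => ?_
    refine Finset.sum_congr rfl fun k _ => ?_
    unfold nodeW
    push_cast
    ring

end Summit.RiemannHypothesis.RiemannHypothesis.Theorems.IntegerScrew.Manifest.Fast
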